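import Mathlib

/-!
# Sketch (crux-ideate round 2, ideator 4) — crux stmt-Langlands-12920 `EisensteinProModularSeed`

First lemma of the idea card `inert-winding-cycle`: the abstract form of the
DIVISIBILITY DICHOTOMY.  Setting (informal dictionary): `M = H²(Y_{K₀(q)}, O)_𝔪`,
`res : M → B = H²(∂Y_{K₀(q)}, O)_𝔪` the (surjective at non-exceptional `𝔪`) boundary
restriction, `ker res = H²_!` (interior = cuspidal ⊕ torsion), `y = α'(e₂, -u e₂)` the
level-raised old straight Eisenstein class whose boundary value is `ϖ^a • b` (S+ to depth `a`),
`Z : M → O` the functional "pair with an integral 2-cycle" (e.g. the capped partial-orbit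
component `Z'` of the modular curve at an inert `q`).  Conclusion: if the period `Z y` is NOT
divisible by `ϖ^a`, the interior `ker res` contains a non-torsion element, i.e. (dictionary)
a characteristic-0 CUSPIDAL class at the straight Eisenstein ideal `𝔪` — the seed at level
`cond · q`.  Torsion never enters: a linear functional to a domain kills torsion.
-/

namespace Summit.Langlands.Langlands.Cruxes.EisensteinProModularSeed.SketchIdeator4

/-- **Period detection of level-raising (abstract divisibility dichotomy).**
If `res y = ϖ^a • b` and some `O`-linear functional `Z` has `Z y ∉ (ϖ^a)`, then `ker res`
contains an element on which no non-zero scalar acts by zero (a non-torsion interior class).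
[folklore] -/
theorem period_detects_nontorsion {O M B : Type*} [CommRing O] [IsDomain O]
    [AddCommGroup M] [Module O M] [AddCommGroup B] [Module O B]
    (res : M →ₗ[O] B) (hres : Function.Surjective res) (Z : M →ₗ[O] O)
    (y : M) (ϖ : O) (a : ℕ) (b : B)
    (hy : res y = ϖ ^ a • b) (hZ : Z y ∉ Ideal.span ({ϖ ^ a} : Set O)) :
    ∃ t ∈ LinearMap.ker res, Z t ≠ 0 ∧ ∀ c : O, c ≠ 0 → c • t ≠ 0 := by
  obtain ⟨x, hx⟩ := hres b
  refine ⟨y - ϖ ^ a • x, ?_, ?_, ?_⟩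
  · rw [LinearMap.mem_ker, map_sub, map_smul, hx, hy, sub_self]
  · intro h
    apply hZ
    have h' : Z y = ϖ ^ a * Z x := by
      have := h
      rw [map_sub, map_smul, smul_eq_mul, sub_eq_zero] at this
      exact this
    rw [h']
    exact Ideal.mul_mem_right _ _ (Ideal.subset_span rfl)
  · intro c hc hct
    apply hZ
    have h1 : c * Z (y - ϖ ^ a • x) = 0 := by
      rw [← smul_eq_mul, ← map_smul, hct, map_zero]
    have h2 : Z (y - ϖ ^ a • x) = 0 := by
      rcases mul_eq_zero.mp h1 with h | h
      · exact absurd h hc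
      · exact h
    rw [map_sub, map_smul, smul_eq_mul, sub_eq_zero] at h2
    rw [h2]
    exact Ideal.mul_mem_right _ _ (Ideal.subset_span rfl)

/-- **Depth beats any fixed valuation (the Chebotarev-depth trick, abstract form).**
If the period `P` is non-zero in a domain where `⋂ₙ (ϖⁿ) = 0` below it — concretely: if
`P ∉ (ϖ^m)` for some `m` — then for every depth `a ≥ m`... stated minimally: a unit multiple of
`P` is not divisible by `ϖ^a` as soon as `P` is not. [folklore] -/
theorem unit_mul_not_mem_span_pow {O : Type*} [CommRing O] (u P ϖ : O) (hu : IsUnit u) (a : ℕ)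
    (hP : P ∉ Ideal.span ({ϖ ^ a} : Set O)) : u * P ∉ Ideal.span ({ϖ ^ a} : Set O) := by
  intro h
  apply hP
  obtain ⟨v, rfl⟩ := hu
  have : (↑v⁻¹ : O) * (↑v * P) ∈ Ideal.span ({ϖ ^ a} : Set O) := Ideal.mul_mem_left _ _ h
  simpa [← mul_assoc] using this

end Summit.Langlands.Langlands.Cruxes.EisensteinProModularSeed.SketchIdeator4
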